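import Literature.AlgebraicGeometry.HodgeTheory.SemiregularVariationalHodgeFull
import Literature.AlgebraicGeometry.HodgeTheory.InvolutionEquivariantSemiregularity
import HarnessLib

/-!
# Perry's semiregularity theorem WITH A `B`-FIELD: `exp(B₀)·ch(E₀)` remains algebraic (Perry 2026, Thm. 1.1 (2), `B₀ ≠ 0`)

Family `hodge`, layer `Literature/AlgebraicGeometry/HodgeTheory`. NAMED CLAIM-FACT (D-0014; source under review),
the `B₀ ≠ 0` companion of `Perry2026_semiregularFull_remainsAlgebraic` (`SemiregularVariationalHodgeFull.lean`,
which renders the case `B₀ = 0`; its module docstring lists "`B_0 ≠ 0`" under "What is NOT here"). Requested by the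
B2b ladder `hodge-weil` (packet `run/shared/lean/b2b/hodge-weil/`, `b2b-hweil-pv2-g2/VARIATIONAL-G2.md` §3, §6 (3)):
Markman's anchor sheaves `E = Φ(F₁ ⊠ F₂^∨)` on `X × X̂` (arXiv:2502.03415) are used through the class
`κ(E) := ch(E) · exp(-c₁(E)/rk E)` (§1.1), i.e. through Perry's theorem with `B₀ = -c₁(E)/r`, NOT with `B₀ = 0`
(their `c₁` does not stay of type `(1,1)` along the Weil family); the untwisted rendering cannot host them. With
the twist, the Hodge-flatness demand is on `exp(B₀)·ch(E₀)` only, so an anchor object may have any `c₁`.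

## Source, verbatim (held text `paper:arxiv-2604.00511`, A. Perry, *The semiregularity theorem for equivariant
## noncommutative varieties*, arXiv:2604.00511, April 2026, UNREFEREED — tagged `[claim …]`)

**Thm. 1.1**: "Let `f : X → S` be a smooth proper family of complex varieties. Let `0 ∈ S(ℂ)` be a point and let
`E_0 ∈ D_perf(X_0)` be a semiregular perfect complex with `Ext^{<0}(E_0, E_0) = 0`. Assume that
`B_0 ∈ H²(X_0, ℚ(1))` is an algebraic class such that `w_0 = exp(B_0) · ch(E_0) ∈ ⊕_{k ≥ 0} H^{2k}(X_0, ℚ(k))`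
remains Hodge along `S`, i.e. lifts to a global section `w` of the local system `⊕_{k ≥ 0} R^{2k}f_*ℚ(k)`. Then:
(1) […] `E_0` deforms as a twisted perfect complex over an étale neighborhood of `0` […] (2) The class `w_0`
remains algebraic along `S`, i.e. for every point `s ∈ S(ℂ)` the fiber `w_s ∈ ⊕_{k ≥ 0} H^{2k}(X_s, ℚ(k))` of `w`
over `s` is algebraic." (the case `𝒞 = D_perf(X)` of Thm. 6.1, "`S` is a complex variety", §1.3; Def. 2.4 /
Rem. 2.5: semiregular = the Buchweitz–Flenner semiregularity map injective).

## Rendering (exactly that of `Perry2026_semiregularFull_remainsAlgebraic`, plus the `B`-field)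

Smooth projective family `π : 𝒳 ⟶ S` of relative dimension `n` over a smooth, integral, quasi-projective `ℂ`-scheme;
continuous sections `s ↦ (s, w_k(s))` of the étalé spaces `FiberClass π (2k)` (all `k ≥ 0`) with values in
`locusOfHodgeClasses` ("remains Hodge"); `E_0` finite locally free (so `Ext^{<0} = 0`) and FULLY semiregular
(`IsISemiregular hE₀ Set.univ`); the `B`-field `B₀ ∈ H²(X_{s₀}(ℂ); ℂ)` RATIONAL and ALGEBRAIC
(`IsRationalClass B₀`, `B₀ ∈ algebraicClasses (X_{s₀}) 1` — "an algebraic class in `H²(X_0, ℚ(1))`"); the anchor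
condition `w_k(s₀) = (exp(B₀) ∪ ch(E₀))_k`, the tree's `expTwistCh C (X_{s₀}) B₀ E₀ k`
(`InvolutionEquivariantSemiregularity.lean`: `Σ_{i ≤ k} (1/i!) B₀ⁱ ∪ ch_{k-i}(E₀)`); conclusion: `w_k(s)` is an
algebraic class of `X_s` for every `s` and `k` (the Tate twists are degreewise non-zero scalars, immaterial).
For `B₀ = 0` this is the untwisted fact (`…_of_twisted`, proved: `expTwistCh C X 0 E k = ch_k(E)`).

## What is NOT here

Perfect complexes / coherent `E_0` (the tree's `sigmaHigher` needs `E_0` finite locally free — Markman's secant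
sheaves are REFLEXIVE, so even this rendering does not host them literally); conclusion (1) (the twisted
deformation); the equivariant Thm. 1.2 / 6.3 (for an involution with fixed points it is a CONJECTURE, summit-side);
singular or non-quasi-projective bases.

## References

* [Perry2026Semiregularity] A. Perry, arXiv:2604.00511 (2026), Thm. 1.1, Def. 2.4, Rem. 2.5, §1.3, Thm. 6.1.
* [BuchweitzFlenner2003] R.-O. Buchweitz, H. Flenner, Compositio Math. 137 (2003), Thm. 5.1, Def. 4.1.
* [HuybrechtsStellari2005] D. Huybrechts, P. Stellari, Math. Ann. 332 (2005), §1 (`ch^B = ch · exp(B)`).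
* [Markman2025SecantWeil] E. Markman, arXiv:2502.03415, §1.1 (`κ(E) = ch(E) exp(-c₁(E)/r)`), §9.
-/

noncomputable section

open CategoryTheory AlgebraicGeometry
open _root_.Topology _root_.Filter
open Literature.AlgebraicTopology.SingularHomology

namespace Literature.AlgebraicGeometry.HodgeTheory

section HodgeTheory

/-- **Perry 2026, Thm. 1.1 (2), with a `B`-field**: along a smooth projective family over a smooth integral
quasi-projective complex base, if `E₀` is a finite locally free FULLY SEMIREGULAR sheaf on the fibre `X_{s₀}`,
`B₀ ∈ H²(X_{s₀}(ℂ); ℂ)` is a rational algebraic class, and the `B₀`-twisted Chern character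
`(exp(B₀) ∪ ch(E₀))_k = expTwistCh C X_{s₀} B₀ E₀ k` is, for every `k`, the value at `s₀` of a continuous section
`w_k` of `R^{2k}π_*ℂ` whose values are rational `(k,k)` classes ("`w_0 = exp(B_0)·ch(E_0)` remains Hodge along
`S`"), then `w_k(s)` is an ALGEBRAIC class of `X_s` for every `s ∈ S(ℂ)` and every `k` ("`w_0` remains algebraic
along `S`"). Rendering and faithfulness: module docstring (the printed statement has `E_0` a perfect complex and any
complex variety `S`; this is its special case). Users take `(h : Perry2026_semiregularTwisted_remainsAlgebraic)`.
[claim: Perry2026Semiregularity, status: under-review] -/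
def Perry2026_semiregularTwisted_remainsAlgebraic : Prop :=
  ∀ (C : ChernCharacterBetti) ⦃𝒳 S : Motives.SchemeOver ℂ⦄ (π : 𝒳 ⟶ S) (n : ℕ),
    Motives.IsSmoothProjectiveFamily π n → IsQuasiProjectiveOver S → IsIntegral S.left →
    _root_.AlgebraicGeometry.Smooth S.hom →
    ∀ (w : ∀ (k : ℕ) (s : Motives.ComplexPoints S), complexBetti (Motives.fiberOver π s) (2 * k)),
      (∀ k, Continuous fun s => (⟨s, w k s⟩ : FiberClass π (2 * k))) →
      (∀ k s, (⟨s, w k s⟩ : FiberClass π (2 * k)) ∈ locusOfHodgeClasses π n k) →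
      ∀ (s₀ : Motives.ComplexPoints S) (E₀ : (Motives.fiberOver π s₀).left.Modules)
        (hE₀ : Motives.IsFiniteLocallyFree E₀), IsISemiregular hE₀ Set.univ →
        ∀ (B₀ : complexBetti (Motives.fiberOver π s₀) 2), IsRationalClass B₀ →
          B₀ ∈ algebraicClasses (Motives.fiberOver π s₀) 1 →
          (∀ k, w k s₀ = expTwistCh C (Motives.fiberOver π s₀) B₀ E₀ k) →
          ∀ (s : Motives.ComplexPoints S) (k : ℕ), w k s ∈ algebraicClasses (Motives.fiberOver π s) k

/-! ### `B₀ = 0`: the twisted fact contains the untwisted one -/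

/-- The `0`-twisted Chern character is the Chern character: `(exp(0) ∪ ch(E))_k = ch_k(E)` (only the term
`i = 0` of `expTwistCh` survives: `0ⁱ = 0` for `i ≥ 1`, `0⁰ = 1` and `1 ∪ x = x`).
[cite: HuybrechtsStellari2005, §1] [folklore] -/
theorem expTwistCh_zero (C : ChernCharacterBetti) (X : Motives.SchemeOver ℂ) (E : X.left.Modules) (k : ℕ) :
    expTwistCh C X 0 E k = C.ch X E k := by
  unfold expTwistCh
  rw [Fin.sum_univ_succ, Finset.sum_eq_zero, add_zero]
  · show ((Nat.factorial 0 : ℕ) : ℂ)⁻¹ • cupProduct _ (cupPowTwo (0 : complexBetti X 2) 0) (C.ch X E (k - 0)) =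
      C.ch X E k
    rw [Nat.factorial_zero, Nat.cast_one, inv_one, one_smul, cupPowTwo_zero]
    show cupProduct (Nat.zero_add (2 * k)) (singularCohomology.one ℂ _) (C.ch X E k) = C.ch X E k
    exact one_cupProduct _
  · intro i _
    have h : cupPowTwo (0 : complexBetti X 2) ((i.succ : Fin (k + 1)) : ℕ) = 0 := by
      rw [Fin.val_succ, cupPowTwo_succ, map_zero]
    rw [h, LinearMap.map_zero₂, smul_zero]

/-- **The untwisted fact from the twisted one** (`B₀ = 0`: `0` is rational and algebraic, and
`expTwistCh C X 0 E k = ch_k(E)`). [claim: Perry2026Semiregularity, status: under-review] -/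
theorem Perry2026_semiregularFull_remainsAlgebraic_of_twisted (h : Perry2026_semiregularTwisted_remainsAlgebraic) :
    Perry2026_semiregularFull_remainsAlgebraic := by
  intro C 𝒳 S π n hπ hS hSi hSs w hwc hwH s₀ E₀ hE₀ hsr hw₀ s k
  refine h C π n hπ hS hSi hSs w hwc hwH s₀ E₀ hE₀ hsr 0 IsRationalClass.zero (Submodule.zero_mem _) ?_ s k
  intro k'
  rw [expTwistCh_zero]
  exact hw₀ k'

end HodgeTheory

end Literature.AlgebraicGeometry.HodgeTheory

end
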